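import Summits.CriticalPhenomena.PercolationContinuityZ3.Theorems.PercNearOneGluingNoHeavyLowerTailSahiGridPatternPairCert

/-!
# `NoHeavyLowerTail` (crux stmt-CriticalPhenomena-4575), Sahi programme P1: **PAIR SUMS OVER TWO BLOCKS AND THEIR `S₃ × S₃` SYMMETRY**
# (bookkeeping for the two-orthant identity)

Support file (Sahi cell, seat `prim-sahi-p1`, generation 21; `--supports stmt-CriticalPhenomena-4575`).  Pure proofs, no definitions,
no `sorry`, standard axioms.  Vocabulary of `…SahiGridPattern{SliceForm,CellForm,PairCert}` (`TotDist`, `thirdPt`, `glue`, `ind`).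

THE MATHEMATICS.  For a kernel `F` of three points of the free block `[3]^n` and three points of the cell block `[3]^k` put
  `PS(F) := Σ_{ξ,η} Σ_{q,r} [ξ δ̸ η]·[q δ̸ r]·F(ξ, η, ξ̄η; q, r, q̄r)`      (`ξ̄η = thirdPt ξ η`),
the sum of `F` over (ordered Latin triple of the free block) × (ordered Latin triple of the cell block).  `PS` is invariant under the
`S₃ × S₃` relabelling of the two Latin triples: the transpositions (`ps_swapI`, `ps_swapJ`: `Finset.sum_comm`) and the rotations
(`ps_rotI`, `ps_rotJ`: reindex `η ↦ ξ̄η`, an involution preserving `ξ δ̸ ·`, with `thirdPt_thirdPt`), hence `PS(Σ_{σ∈S₃} F∘σ) = 6·PS(F)`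
on either block (`ps_symI6`, `ps_symJ6`).  This is the resummation step of the two-orthant identity (`…SahiGridPatternTwoOrthant`):
an identity between SYMMETRISED local kernels implies the identity between the pair sums. [this work]
-/

namespace Summit.CriticalPhenomena.PercolationContinuityZ3.Theorems.SahiGridPattern

open Finset SahiGrid3
open scoped BigOperators

variable {n k : ℕ}

/-! ### The rotation involution `η ↦ thirdPt ξ η` -/

/-- `[ξ δ̸ ξ̄η] = [ξ δ̸ η]` as Booleans. [this work] -/
theorem totDist_thirdPt_eq (ξ η : Pd n) : TotDist ξ (thirdPt ξ η) = TotDist ξ η := by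
  rw [Bool.eq_iff_iff, totDist_thirdPt_iff]

/-- Reindexing a sum along the involution `η ↦ thirdPt ξ η`. [this work] -/
theorem sum_thirdPt_reindex {M : Type*} [AddCommMonoid M] (ξ : Pd n) (G : Pd n → M) :
    (∑ η, G (thirdPt ξ η)) = ∑ η, G η :=
  Equiv.sum_comp (Function.Involutive.toPerm (thirdPt ξ) (fun η => thirdPt_thirdPt ξ η)) G

/-! ### Invariance of the two-block pair sum under the `S₃ × S₃` relabelling -/

/-- **Transposition in the free block**: `PS(F(η,ξ,ζ;·)) = PS(F)`. [this work] -/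
theorem ps_swapI (F : Pd n → Pd n → Pd n → Pd k → Pd k → Pd k → ℤ) :
    (∑ ξ : Pd n, ∑ η : Pd n, ∑ q : Pd k, ∑ r : Pd k, (if TotDist ξ η = true then (1:ℤ) else 0) * (if TotDist q r = true then (1:ℤ) else 0) *
        F η ξ (thirdPt ξ η) q r (thirdPt q r))
      = ∑ ξ : Pd n, ∑ η : Pd n, ∑ q : Pd k, ∑ r : Pd k, (if TotDist ξ η = true then (1:ℤ) else 0) * (if TotDist q r = true then (1:ℤ) else 0) *
        F ξ η (thirdPt ξ η) q r (thirdPt q r) := by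
  rw [Finset.sum_comm]
  refine Finset.sum_congr rfl fun ξ _ => Finset.sum_congr rfl fun η _ => Finset.sum_congr rfl fun q _ => Finset.sum_congr rfl fun r _ => ?_
  rw [totDist_symm η ξ, thirdPt_comm η ξ]

/-- **Rotation in the free block**: `PS(F(ξ,ζ,η;·)) = PS(F)` (reindex `η ↦ ξ̄η`). [this work] -/
theorem ps_rotI (F : Pd n → Pd n → Pd n → Pd k → Pd k → Pd k → ℤ) :
    (∑ ξ : Pd n, ∑ η : Pd n, ∑ q : Pd k, ∑ r : Pd k, (if TotDist ξ η = true then (1:ℤ) else 0) * (if TotDist q r = true then (1:ℤ) else 0) *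
        F ξ (thirdPt ξ η) η q r (thirdPt q r))
      = ∑ ξ : Pd n, ∑ η : Pd n, ∑ q : Pd k, ∑ r : Pd k, (if TotDist ξ η = true then (1:ℤ) else 0) * (if TotDist q r = true then (1:ℤ) else 0) *
        F ξ η (thirdPt ξ η) q r (thirdPt q r) := by
  refine Finset.sum_congr rfl fun ξ _ => ?_
  rw [← sum_thirdPt_reindex ξ (fun η => ∑ q : Pd k, ∑ r : Pd k, (if TotDist ξ η = true then (1:ℤ) else 0) *
    (if TotDist q r = true then (1:ℤ) else 0) * F ξ η (thirdPt ξ η) q r (thirdPt q r))]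
  refine Finset.sum_congr rfl fun η _ => ?_
  simp only [totDist_thirdPt_eq, thirdPt_thirdPt]

/-- **Transposition in the cell block**: `PS(F(·;r,q,w)) = PS(F)`. [this work] -/
theorem ps_swapJ (F : Pd n → Pd n → Pd n → Pd k → Pd k → Pd k → ℤ) :
    (∑ ξ : Pd n, ∑ η : Pd n, ∑ q : Pd k, ∑ r : Pd k, (if TotDist ξ η = true then (1:ℤ) else 0) * (if TotDist q r = true then (1:ℤ) else 0) *
        F ξ η (thirdPt ξ η) r q (thirdPt q r))
      = ∑ ξ : Pd n, ∑ η : Pd n, ∑ q : Pd k, ∑ r : Pd k, (if TotDist ξ η = true then (1:ℤ) else 0) * (if TotDist q r = true then (1:ℤ) else 0) *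
        F ξ η (thirdPt ξ η) q r (thirdPt q r) := by
  refine Finset.sum_congr rfl fun ξ _ => Finset.sum_congr rfl fun η _ => ?_
  rw [Finset.sum_comm]
  refine Finset.sum_congr rfl fun q _ => Finset.sum_congr rfl fun r _ => ?_
  rw [totDist_symm r q, thirdPt_comm r q]

/-- **Rotation in the cell block**: `PS(F(·;q,w,r)) = PS(F)` (reindex `r ↦ q̄r`). [this work] -/
theorem ps_rotJ (F : Pd n → Pd n → Pd n → Pd k → Pd k → Pd k → ℤ) :
    (∑ ξ : Pd n, ∑ η : Pd n, ∑ q : Pd k, ∑ r : Pd k, (if TotDist ξ η = true then (1:ℤ) else 0) * (if TotDist q r = true then (1:ℤ) else 0) *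
        F ξ η (thirdPt ξ η) q (thirdPt q r) r)
      = ∑ ξ : Pd n, ∑ η : Pd n, ∑ q : Pd k, ∑ r : Pd k, (if TotDist ξ η = true then (1:ℤ) else 0) * (if TotDist q r = true then (1:ℤ) else 0) *
        F ξ η (thirdPt ξ η) q r (thirdPt q r) := by
  refine Finset.sum_congr rfl fun ξ _ => Finset.sum_congr rfl fun η _ => Finset.sum_congr rfl fun q _ => ?_
  rw [← sum_thirdPt_reindex q (fun r => (if TotDist ξ η = true then (1:ℤ) else 0) *
    (if TotDist q r = true then (1:ℤ) else 0) * F ξ η (thirdPt ξ η) q r (thirdPt q r))]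
  refine Finset.sum_congr rfl fun r _ => ?_
  simp only [totDist_thirdPt_eq, thirdPt_thirdPt]

/-- **Symmetrisation over the free-block `S₃`**: the pair sum of the six relabellings of `F` in its free-block arguments is `6·PS(F)`.
[this work] -/
theorem ps_symI6 (F : Pd n → Pd n → Pd n → Pd k → Pd k → Pd k → ℤ) :
    (∑ ξ : Pd n, ∑ η : Pd n, ∑ q : Pd k, ∑ r : Pd k, (if TotDist ξ η = true then (1:ℤ) else 0) * (if TotDist q r = true then (1:ℤ) else 0) *
        (F ξ η (thirdPt ξ η) q r (thirdPt q r) + F η ξ (thirdPt ξ η) q r (thirdPt q r) + F ξ (thirdPt ξ η) η q r (thirdPt q r)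
          + F η (thirdPt ξ η) ξ q r (thirdPt q r) + F (thirdPt ξ η) ξ η q r (thirdPt q r) + F (thirdPt ξ η) η ξ q r (thirdPt q r)))
      = 6 * ∑ ξ : Pd n, ∑ η : Pd n, ∑ q : Pd k, ∑ r : Pd k, (if TotDist ξ η = true then (1:ℤ) else 0) * (if TotDist q r = true then (1:ℤ) else 0) *
        F ξ η (thirdPt ξ η) q r (thirdPt q r) := by
  have h1 := ps_swapI F
  have h2 := ps_rotI F
  have h3 : (∑ ξ : Pd n, ∑ η : Pd n, ∑ q : Pd k, ∑ r : Pd k, (if TotDist ξ η = true then (1:ℤ) else 0) * (if TotDist q r = true then (1:ℤ) else 0) *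
        F η (thirdPt ξ η) ξ q r (thirdPt q r)) = ∑ ξ : Pd n, ∑ η : Pd n, ∑ q : Pd k, ∑ r : Pd k,
        (if TotDist ξ η = true then (1:ℤ) else 0) * (if TotDist q r = true then (1:ℤ) else 0) * F ξ η (thirdPt ξ η) q r (thirdPt q r) :=
    (ps_swapI (fun ξ η ζ q r w => F ξ ζ η q r w)).trans (ps_rotI F)
  have h4 : (∑ ξ : Pd n, ∑ η : Pd n, ∑ q : Pd k, ∑ r : Pd k, (if TotDist ξ η = true then (1:ℤ) else 0) * (if TotDist q r = true then (1:ℤ) else 0) *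
        F (thirdPt ξ η) ξ η q r (thirdPt q r)) = ∑ ξ : Pd n, ∑ η : Pd n, ∑ q : Pd k, ∑ r : Pd k,
        (if TotDist ξ η = true then (1:ℤ) else 0) * (if TotDist q r = true then (1:ℤ) else 0) * F ξ η (thirdPt ξ η) q r (thirdPt q r) :=
    (ps_rotI (fun ξ η ζ q r w => F η ξ ζ q r w)).trans (ps_swapI F)
  have h5 : (∑ ξ : Pd n, ∑ η : Pd n, ∑ q : Pd k, ∑ r : Pd k, (if TotDist ξ η = true then (1:ℤ) else 0) * (if TotDist q r = true then (1:ℤ) else 0) *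
        F (thirdPt ξ η) η ξ q r (thirdPt q r)) = ∑ ξ : Pd n, ∑ η : Pd n, ∑ q : Pd k, ∑ r : Pd k,
        (if TotDist ξ η = true then (1:ℤ) else 0) * (if TotDist q r = true then (1:ℤ) else 0) * F ξ η (thirdPt ξ η) q r (thirdPt q r) :=
    (ps_swapI (fun ξ η ζ q r w => F ζ ξ η q r w)).trans h4
  simp only [mul_add, Finset.sum_add_distrib]
  rw [h1, h2, h3, h4, h5]
  ring

/-- **Symmetrisation over the cell-block `S₃`**: the pair sum of the six relabellings of `F` in its cell-block arguments is `6·PS(F)`.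
[this work] -/
theorem ps_symJ6 (F : Pd n → Pd n → Pd n → Pd k → Pd k → Pd k → ℤ) :
    (∑ ξ : Pd n, ∑ η : Pd n, ∑ q : Pd k, ∑ r : Pd k, (if TotDist ξ η = true then (1:ℤ) else 0) * (if TotDist q r = true then (1:ℤ) else 0) *
        (F ξ η (thirdPt ξ η) q r (thirdPt q r) + F ξ η (thirdPt ξ η) r q (thirdPt q r) + F ξ η (thirdPt ξ η) q (thirdPt q r) r
          + F ξ η (thirdPt ξ η) r (thirdPt q r) q + F ξ η (thirdPt ξ η) (thirdPt q r) q r + F ξ η (thirdPt ξ η) (thirdPt q r) r q))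
      = 6 * ∑ ξ : Pd n, ∑ η : Pd n, ∑ q : Pd k, ∑ r : Pd k, (if TotDist ξ η = true then (1:ℤ) else 0) * (if TotDist q r = true then (1:ℤ) else 0) *
        F ξ η (thirdPt ξ η) q r (thirdPt q r) := by
  have h1 := ps_swapJ F
  have h2 := ps_rotJ F
  have h3 : (∑ ξ : Pd n, ∑ η : Pd n, ∑ q : Pd k, ∑ r : Pd k, (if TotDist ξ η = true then (1:ℤ) else 0) * (if TotDist q r = true then (1:ℤ) else 0) *
        F ξ η (thirdPt ξ η) r (thirdPt q r) q) = ∑ ξ : Pd n, ∑ η : Pd n, ∑ q : Pd k, ∑ r : Pd k,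
        (if TotDist ξ η = true then (1:ℤ) else 0) * (if TotDist q r = true then (1:ℤ) else 0) * F ξ η (thirdPt ξ η) q r (thirdPt q r) :=
    (ps_swapJ (fun ξ η ζ q r w => F ξ η ζ q w r)).trans (ps_rotJ F)
  have h4 : (∑ ξ : Pd n, ∑ η : Pd n, ∑ q : Pd k, ∑ r : Pd k, (if TotDist ξ η = true then (1:ℤ) else 0) * (if TotDist q r = true then (1:ℤ) else 0) *
        F ξ η (thirdPt ξ η) (thirdPt q r) q r) = ∑ ξ : Pd n, ∑ η : Pd n, ∑ q : Pd k, ∑ r : Pd k,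
        (if TotDist ξ η = true then (1:ℤ) else 0) * (if TotDist q r = true then (1:ℤ) else 0) * F ξ η (thirdPt ξ η) q r (thirdPt q r) :=
    (ps_rotJ (fun ξ η ζ q r w => F ξ η ζ r q w)).trans (ps_swapJ F)
  have h5 : (∑ ξ : Pd n, ∑ η : Pd n, ∑ q : Pd k, ∑ r : Pd k, (if TotDist ξ η = true then (1:ℤ) else 0) * (if TotDist q r = true then (1:ℤ) else 0) *
        F ξ η (thirdPt ξ η) (thirdPt q r) r q) = ∑ ξ : Pd n, ∑ η : Pd n, ∑ q : Pd k, ∑ r : Pd k,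
        (if TotDist ξ η = true then (1:ℤ) else 0) * (if TotDist q r = true then (1:ℤ) else 0) * F ξ η (thirdPt ξ η) q r (thirdPt q r) :=
    (ps_swapJ (fun ξ η ζ q r w => F ξ η ζ w q r)).trans h4
  simp only [mul_add, Finset.sum_add_distrib]
  rw [h1, h2, h3, h4, h5]
  ring

end Summit.CriticalPhenomena.PercolationContinuityZ3.Theorems.SahiGridPattern
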